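import Summits.CriticalPhenomena.SAWScalingLimit.Theorems.SAWRenewalTightnessConfinementPositivityChainTuples
import Summits.CriticalPhenomena.SAWScalingLimit.Theorems.SAWRenewalTightnessConfinementPositivityExtentOfExpTail
import Literature.Probability.RandomPlanarGeometry.SAWWordBridges
import HarnessLib

/-!
# Crux `ConfinementPositivity` (stmt-CriticalPhenomena-17587), line `Sketch` (sign-universality):
# stub Den `stub_pinnedDenominator` — AR → USP → PinnedAtomCeiling

Registered stub Den of the lead skeleton `Cruxes/ConfinementPositivity/Lines/Sketch.lean` (v4).  Kesten
chains are lists of irreducible bridge words (pieces) weighted by `x_c^{Σ|pieces|}`; `u_n` is the mass of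
the chains of total span `n`.  If ONE piece of span `s` has every end-height atom `≤ (C/s)·mass{span s}`
(AR) and the chains of span `n` all of whose pieces have `K·span < n` carry `≤ (C_U/K²)·u_n` (USP), then
the end height `wEnd l.flatten 1 = Σ_j wEnd (piece j) 1` of a chain of span `n ≥ 1` has every atom
`≤ (C(1 + 4 C_U)/n)·u_n`.

Proof (one cut, dyadic classes), over tuples `f : Fin k → pieces` (`Theorems.chainSpanMass_eq_tsum_tuples`).
A tuple of total span `n ≥ 1` (spans `≥ 1`) has a least level `c` at which some piece has `2^c·span ≥ n`
and a FIRST such piece `i` (`PinnedDen.cover`), so it lies in a class `(m, K) = (1, 0)` or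
`(2^{c'+1}, 2^{c'})`: `n ≤ m·spanᵢ`, `m·spanⱼ < n (j < i)`, `K·spanⱼ < n (∀ j)` — conditions on the spans
only, met by at most one `i` (`PinnedDen.sum_ite_le_ite`).  For fixed `i` the tuple sum factorises through
`Fin.insertNth` (`PinnedDen.tsum_insertNth`); with the other coordinates frozen the cut piece has a
prescribed span `s ≥ n/m` and a prescribed height, so AR bounds it by `(C/s)·mass{span s} ≤ (Cm/n)·mass`
(`PinnedDen.coord_pin`, `pin_at`), and re-inserting an arbitrary piece of span `s` bounds the pinned class
mass by `(Cm/n)·mass{all pieces K·span < n}` (`PinnedDen.class_bound`), i.e. by `(Cm/n)(C_U/K²)·u_n` (USP;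
for the class `(1, 0)` by `u_n`).  The geometric series over `c` (`PinnedDen.const_sum`) gives
`C' = C(1 + 4C_U)`.  All in `ℝ≥0∞`; the real indicator sums of AR are converted by
`ExtentOfExpTail.ofReal_tsum_indicator`.  No definitions.
-/

noncomputable section

open scoped BigOperators ENNReal
open Classical
open Literature.Probability.LatticeModels
open Literature.Probability.RandomPlanarGeometry Literature.Probability.RandomPlanarGeometry.SAW

namespace Summit.CriticalPhenomena.SAWScalingLimit.Theorems

namespace PinnedDen

variable {P : Type*}

/-! ### Generic `ℝ≥0∞` bookkeeping -/

/-- Fibrewise summation: `Σ'_p w p · G (sp p) = Σ'_σ (Σ'_{sp p = σ} w p) · G σ` (any value type). -/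
theorem tsum_fiber {S : Type*} [DecidableEq S] (w : P → ℝ≥0∞) (sp : P → S) (G : S → ℝ≥0∞) :
    ∑' p, w p * G (sp p) = ∑' σ, (∑' p, if sp p = σ then w p else 0) * G σ := by
  symm
  calc ∑' σ, (∑' p, if sp p = σ then w p else 0) * G σ
      = ∑' σ, ∑' p, (if sp p = σ then w p else 0) * G σ := tsum_congr fun σ => ENNReal.tsum_mul_right.symm
    _ = ∑' p, ∑' σ, (if sp p = σ then w p else 0) * G σ := ENNReal.tsum_comm
    _ = ∑' p, w p * G (sp p) := by
        refine tsum_congr fun p => ?_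
        rw [tsum_eq_single (sp p)]
        · rw [if_pos rfl]
        · intro σ hσ
          rw [if_neg (Ne.symm hσ), zero_mul]

/-- **One-coordinate pinning (abstract).**  Pieces `p : P` (weight `ν`, span `sp`, height `Ht`) against
frozen remainders `g : G` (weight `μ`, height `Hg`), with a side condition `R` depending on the piece only
through its span.  If on every span fibre allowed by `R` each height atom is at most `α` times the fibre
mass, then pinning the total height costs at most the factor `α`. -/
theorem coord_pin {G : Type*} (ν : P → ℝ≥0∞) (μ : G → ℝ≥0∞) (sp Ht : P → ℤ) (Hg : G → ℤ)
    (R : ℤ → G → Prop) [∀ s g, Decidable (R s g)] (α : ℝ≥0∞)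
    (hAR : ∀ (s : ℤ) (g : G) (t : ℤ), R s g →
      (∑' p, if (sp p = s ∧ Ht p = t) then ν p else 0) ≤ α * ∑' p, if sp p = s then ν p else 0)
    (h : ℤ) :
    (∑' p, ∑' g, if (R (sp p) g ∧ Ht p + Hg g = h) then ν p * μ g else 0) ≤
      α * ∑' p, ∑' g, if R (sp p) g then ν p * μ g else 0 := by
  rw [ENNReal.tsum_comm, ENNReal.tsum_comm (f := fun p g => if R (sp p) g then ν p * μ g else 0),
    ← ENNReal.tsum_mul_left]
  refine ENNReal.tsum_le_tsum fun g => ?_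
  -- AR on the fibre `sp = σ`, with the frozen factor `μ g` and the frozen height `Hg g`
  have hAR2 : ∀ σ, R σ g → (∑' p, if sp p = σ then (if Ht p = h - Hg g then ν p * μ g else 0) else 0) ≤
      α * ∑' p, if sp p = σ then ν p * μ g else 0 := fun σ hR => by
    have h1 := mul_le_mul_left (hAR σ g (h - Hg g) hR) (μ g)
    rw [mul_assoc, ← ENNReal.tsum_mul_right, ← ENNReal.tsum_mul_right] at h1
    simpa only [ite_zero_mul, ite_and] using h1
  calc (∑' p, if (R (sp p) g ∧ Ht p + Hg g = h) then ν p * μ g else 0)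
      = ∑' p, (if Ht p = h - Hg g then ν p * μ g else 0) * (if R (sp p) g then 1 else 0) :=
        tsum_congr fun p => by
          by_cases hR : R (sp p) g <;> by_cases hH : Ht p + Hg g = h <;> simp [hR, hH, eq_sub_iff_add_eq]
    _ = ∑' σ, (∑' p, if sp p = σ then (if Ht p = h - Hg g then ν p * μ g else 0) else 0) *
          (if R σ g then 1 else 0) :=
        tsum_fiber (fun p => if Ht p = h - Hg g then ν p * μ g else 0) sp fun σ => if R σ g then 1 else 0
    _ ≤ ∑' σ, (α * ∑' p, if sp p = σ then ν p * μ g else 0) * (if R σ g then 1 else 0) :=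
        ENNReal.tsum_le_tsum fun σ => by
          by_cases hR : R σ g
          · exact mul_le_mul_left (hAR2 σ hR) _
          · simp [hR]
    _ = α * ∑' σ, (∑' p, if sp p = σ then ν p * μ g else 0) * (if R σ g then 1 else 0) := by
        rw [← ENNReal.tsum_mul_left]
        simp only [mul_assoc]
    _ = α * ∑' p, ν p * μ g * (if R (sp p) g then 1 else 0) := by rw [← tsum_fiber]
    _ = α * ∑' p, if R (sp p) g then ν p * μ g else 0 :=
        congrArg _ (tsum_congr fun p => by by_cases hR : R (sp p) g <;> simp [hR])

/-! ### Splitting a tuple sum at one coordinate (`Fin.insertNth`) -/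

/-- A `tsum` over `Fin (k+1) → P` is an iterated `tsum` over the `i`-th piece and the remaining `k`-tuple. -/
theorem tsum_insertNth (k : ℕ) (i : Fin (k + 1)) (F : (Fin (k + 1) → P) → ℝ≥0∞) :
    ∑' f : Fin (k + 1) → P, F f = ∑' p : P, ∑' g : Fin k → P, F (i.insertNth p g) := by
  rw [← (Fin.insertNthEquiv (fun _ : Fin (k + 1) => P) i).tsum_eq F, ENNReal.tsum_prod']
  rfl

/-- **Pinning one coordinate of a tuple sum.**  For a span-only side condition `R` on `(k+1)`-tuples and a
coordinate `i`: if on every span value `v i` allowed by `R` each height atom of one piece is at most `α`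
times the fibre mass, then additionally pinning the total height of the tuple costs at most `α`. -/
theorem pin_at (ν : P → ℝ≥0∞) (sp Ht : P → ℤ) {k : ℕ} (i : Fin (k + 1))
    (R : (Fin (k + 1) → ℤ) → Prop) [DecidablePred R] (α : ℝ≥0∞)
    (hAR : ∀ (v : Fin (k + 1) → ℤ) (t : ℤ), R v →
      (∑' p, if (sp p = v i ∧ Ht p = t) then ν p else 0) ≤ α * ∑' p, if sp p = v i then ν p else 0)
    (h : ℤ) :
    (∑' f : Fin (k + 1) → P,
        if (R (fun j => sp (f j)) ∧ (∑ j, Ht (f j)) = h) then ∏ j, ν (f j) else 0) ≤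
      α * ∑' f : Fin (k + 1) → P, if R (fun j => sp (f j)) then ∏ j, ν (f j) else 0 := by
  rw [tsum_insertNth k i, tsum_insertNth k i (fun f => if R (fun j => sp (f j)) then ∏ j, ν (f j) else 0)]
  -- along `insertNth`: the span vector, the total height and the weight split off the `i`-th piece
  have hRi : ∀ (p : P) (g : Fin k → P),
      R (fun j => sp ((i.insertNth p g : Fin (k + 1) → P) j)) = R (i.insertNth (sp p) fun j => sp (g j)) :=
    fun p g => congrArg R (funext ((Fin.forall_iff_succAbove i).2 ⟨by simp, fun j => by simp⟩))
  simp only [hRi, Fin.sum_univ_succAbove _ i, Fin.prod_univ_succAbove _ i, Fin.insertNth_apply_same,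
    Fin.insertNth_apply_succAbove]
  exact coord_pin ν (fun g : Fin k → P => ∏ j, ν (g j)) sp Ht (fun g => ∑ j, Ht (g j))
    (fun s g => R (i.insertNth s fun j => sp (g j))) α
    (fun s g t hR => by simpa only [Fin.insertNth_apply_same] using hAR _ t hR) h

/-! ### The classes: uniqueness and coverage of the first big piece -/

/-- A finite sum of indicators of pairwise incompatible events, each implying `T`, is at most the
indicator of `T`. -/
theorem sum_ite_le_ite {k : ℕ} (X : ℝ≥0∞) (Q : Fin k → Prop) [DecidablePred Q] (T : Prop) [Decidable T]
    (hQT : ∀ i, Q i → T) (huniq : ∀ i i', Q i → Q i' → i = i') :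
    (∑ i, if Q i then X else 0) ≤ if T then X else 0 := by
  by_cases hex : ∃ i, Q i
  · obtain ⟨i₀, hi₀⟩ := hex
    rw [Finset.sum_eq_single i₀ (fun j _ hj => if_neg fun hQj => hj (huniq j i₀ hQj hi₀))
      (fun h => absurd (Finset.mem_univ i₀) h), if_pos hi₀, if_pos (hQT i₀ hi₀)]
  · push Not at hex
    rw [Finset.sum_eq_zero (fun i _ => if_neg (hex i))]
    exact zero_le

/-- **Coverage by the dyadic classes.**  A vector of spans `≥ 1` with total `n ≥ 1` has a least level `c`
with a piece of `2^c · span ≥ n` and a first such piece `i`; so it lies in the class `(m, K) = (1, 0)`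
(`c = 0`) or `(2^{c'+1}, 2^{c'})` (`c = c' + 1`). -/
theorem cover {k : ℕ} (n : ℕ) (hn : 1 ≤ n) (v : Fin k → ℤ) (hv : ∀ j, 1 ≤ v j)
    (hsum : (∑ j, v j) = (n : ℤ)) :
    (∃ i : Fin k, ((n : ℤ) ≤ ((1 : ℕ) : ℤ) * v i ∧
        ∀ j : Fin k, (j : ℕ) < (i : ℕ) → ((1 : ℕ) : ℤ) * v j < (n : ℤ)) ∧
        ∀ j : Fin k, ((0 : ℕ) : ℤ) * v j < (n : ℤ)) ∨
      ∃ (c : ℕ) (i : Fin k), ((n : ℤ) ≤ ((2 ^ (c + 1) : ℕ) : ℤ) * v i ∧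
        ∀ j : Fin k, (j : ℕ) < (i : ℕ) → ((2 ^ (c + 1) : ℕ) : ℤ) * v j < (n : ℤ)) ∧
        ∀ j : Fin k, ((2 ^ c : ℕ) : ℤ) * v j < (n : ℤ) := by
  -- there is a piece
  have hk : 0 < k := by
    rcases Nat.eq_zero_or_pos k with rfl | hk
    · simp at hsum
      omega
    · exact hk
  -- some level has a big piece (`c = n`: `2^n ≥ n`, spans `≥ 1`)
  have hex : ∃ c : ℕ, ∃ j : Fin k, (n : ℤ) ≤ ((2 ^ c : ℕ) : ℤ) * v j := by
    refine ⟨n, ⟨0, hk⟩, ?_⟩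
    have h1 : (n : ℤ) ≤ ((2 ^ n : ℕ) : ℤ) := by exact_mod_cast (Nat.lt_two_pow_self).le
    calc (n : ℤ) ≤ ((2 ^ n : ℕ) : ℤ) := h1
      _ = ((2 ^ n : ℕ) : ℤ) * 1 := (mul_one _).symm
      _ ≤ ((2 ^ n : ℕ) : ℤ) * v ⟨0, hk⟩ := mul_le_mul_of_nonneg_left (hv _) (by positivity)
  -- the least such level `c₀` and, at that level, the first big index `i`
  obtain ⟨c₀, ⟨j₀, hj₀⟩, hmin⟩ : ∃ c₀ : ℕ, (∃ j : Fin k, (n : ℤ) ≤ ((2 ^ c₀ : ℕ) : ℤ) * v j) ∧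
      ∀ c < c₀, ¬ ∃ j : Fin k, (n : ℤ) ≤ ((2 ^ c : ℕ) : ℤ) * v j :=
    ⟨Nat.find hex, Nat.find_spec hex, fun c hc => Nat.find_min hex hc⟩
  have hmin' : ∀ c < c₀, ∀ j : Fin k, ((2 ^ c : ℕ) : ℤ) * v j < (n : ℤ) :=
    fun c hc j => not_le.1 fun hle => hmin c hc ⟨j, hle⟩
  obtain ⟨i, hi⟩ : ∃ i : Fin k, (n : ℤ) ≤ ((2 ^ c₀ : ℕ) : ℤ) * v i ∧
      ∀ j : Fin k, (j : ℕ) < (i : ℕ) → ((2 ^ c₀ : ℕ) : ℤ) * v j < (n : ℤ) := by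
    have hexj : ∃ j : ℕ, ∃ hj : j < k, (n : ℤ) ≤ ((2 ^ c₀ : ℕ) : ℤ) * v ⟨j, hj⟩ := ⟨j₀, j₀.isLt, hj₀⟩
    refine ⟨⟨Nat.find hexj, (Nat.find_spec hexj).fst⟩, (Nat.find_spec hexj).snd, fun j hj => ?_⟩
    exact not_le.1 fun hle => Nat.find_min hexj hj ⟨j.isLt, hle⟩
  rcases c₀ with _ | c
  · left
    refine ⟨i, by simpa using hi, fun j => ?_⟩
    simp only [Nat.cast_zero, zero_mul]
    exact_mod_cast hn
  · right
    exact ⟨c, i, hi, hmin' c (Nat.lt_succ_self c)⟩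

/-! ### The per-class bound -/

/-- **Per-class pinned bound.**  Pieces with weight `ν`, span `sp`, height `Ht`; a cut condition `Rm k i`
and a dust condition `RK k` on span vectors, `Rm` selecting at most one coordinate `i`, and AR with factor `α`
on the span fibre of the cut piece.  Then the height-pinned mass of the tuples of total span `n` in the class
is at most `α` times the mass of the tuples of total span `n` satisfying the dust condition. -/
theorem class_bound (ν : P → ℝ≥0∞) (sp Ht : P → ℤ) (α : ℝ≥0∞) (n h : ℤ)
    (Rm : (k : ℕ) → Fin k → (Fin k → ℤ) → Prop) (RK : (k : ℕ) → (Fin k → ℤ) → Prop)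
    [∀ k i v, Decidable (Rm k i v)] [∀ k v, Decidable (RK k v)]
    (huniq : ∀ (k : ℕ) (v : Fin k → ℤ) (i i' : Fin k), Rm k i v → Rm k i' v → i = i')
    (hAR : ∀ (k : ℕ) (v : Fin k → ℤ) (i : Fin k) (t : ℤ), Rm k i v →
      (∑' p, if (sp p = v i ∧ Ht p = t) then ν p else 0) ≤ α * ∑' p, if sp p = v i then ν p else 0) :
    (∑' k : ℕ, ∑' f : Fin k → P, ∑ i : Fin k,
        if (((∑ j, sp (f j)) = n ∧ Rm k i (fun j => sp (f j)) ∧ RK k (fun j => sp (f j))) ∧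
            (∑ j, Ht (f j)) = h) then ∏ j, ν (f j) else 0) ≤
      α * ∑' k : ℕ, ∑' f : Fin k → P,
        if ((∑ j, sp (f j)) = n ∧ RK k (fun j => sp (f j))) then ∏ j, ν (f j) else 0 := by
  rw [← ENNReal.tsum_mul_left]
  refine ENNReal.tsum_le_tsum fun k => ?_
  cases k with
  | zero => simp
  | succ k =>
    -- one cut position at a time (`pin_at`), then at most one position qualifies (`sum_ite_le_ite`)
    rw [Summable.tsum_finsetSum fun i _ => ENNReal.summable]
    refine (Finset.sum_le_sum fun i _ => pin_at ν sp Ht i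
      (fun v => (∑ j, v j) = n ∧ Rm (k + 1) i v ∧ RK (k + 1) v) α
      (fun v t hv => hAR (k + 1) v i t hv.2.1) h).trans ?_
    rw [← Finset.mul_sum, ← Summable.tsum_finsetSum fun i _ => ENNReal.summable]
    refine mul_le_mul_right (ENNReal.tsum_le_tsum fun f => ?_) _
    exact sum_ite_le_ite _ _ _ (fun i hi => ⟨hi.1, hi.2.2⟩) fun i i' hi hi' =>
      huniq _ _ i i' hi.2.1 hi'.2.1

/-! ### Sums of bounds and constants -/

/-- Summing pointwise bounds of the form `F ≤ A + Σ'_c B c` over all tuples. -/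
theorem tsum_cover (F A : (k : ℕ) → (Fin k → P) → ℝ≥0∞) (B : ℕ → (k : ℕ) → (Fin k → P) → ℝ≥0∞)
    (hle : ∀ k f, F k f ≤ A k f + ∑' c, B c k f) :
    (∑' k, ∑' f : Fin k → P, F k f) ≤
      (∑' k, ∑' f : Fin k → P, A k f) + ∑' c, ∑' k, ∑' f : Fin k → P, B c k f := by
  calc (∑' k, ∑' f : Fin k → P, F k f)
      ≤ ∑' k, ∑' f : Fin k → P, (A k f + ∑' c, B c k f) :=
        ENNReal.tsum_le_tsum fun k => ENNReal.tsum_le_tsum fun f => hle k f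
    _ = (∑' k, ∑' f : Fin k → P, A k f) + ∑' k, ∑' f : Fin k → P, ∑' c, B c k f := by
        rw [← ENNReal.tsum_add]
        exact tsum_congr fun k => ENNReal.tsum_add
    _ = (∑' k, ∑' f : Fin k → P, A k f) + ∑' c, ∑' k, ∑' f : Fin k → P, B c k f := by
        rw [ENNReal.tsum_comm (f := fun c k => ∑' f : Fin k → P, B c k f)]
        exact congrArg _ (tsum_congr fun k => ENNReal.tsum_comm)

/-- Dropping a conjunct of the side condition only increases a double `tsum` of indicators. -/
theorem tsum_tsum_ite_and_le (A B : (k : ℕ) → (Fin k → P) → Prop) [∀ k f, Decidable (A k f)]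
    [∀ k f, Decidable (B k f)] (X : (k : ℕ) → (Fin k → P) → ℝ≥0∞) :
    (∑' k, ∑' f : Fin k → P, if (A k f ∧ B k f) then X k f else 0) ≤
      ∑' k, ∑' f : Fin k → P, if A k f then X k f else 0 :=
  ENNReal.tsum_le_tsum fun k => ENNReal.tsum_le_tsum fun f => by
    by_cases hA : A k f <;> by_cases hB : B k f <;> simp [hA, hB]

/-- USP as a division: `K² M ≤ U u` gives `M ≤ (U/K²) u` (`K ≥ 1`). -/
theorem usp_div (K : ℕ) (hK : 1 ≤ K) (M u : ℝ≥0∞) (U : ℝ)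
    (h : (K : ℝ≥0∞) ^ 2 * M ≤ ENNReal.ofReal U * u) : M ≤ ENNReal.ofReal (U / (K : ℝ) ^ 2) * u := by
  have hK0 : (K : ℝ≥0∞) ^ 2 ≠ 0 := pow_ne_zero _ (Nat.cast_ne_zero.2 (by omega))
  have hKt : (K : ℝ≥0∞) ^ 2 ≠ ⊤ := ENNReal.pow_ne_top (ENNReal.natCast_ne_top K)
  have hKR : (0 : ℝ) < (K : ℝ) ^ 2 := by positivity
  rw [ENNReal.ofReal_div_of_pos hKR, ENNReal.ofReal_pow (Nat.cast_nonneg _), ENNReal.ofReal_natCast]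
  calc M = ((K : ℝ≥0∞) ^ 2)⁻¹ * ((K : ℝ≥0∞) ^ 2 * M) := by
        rw [← mul_assoc, ENNReal.inv_mul_cancel hK0 hKt, one_mul]
    _ ≤ ((K : ℝ≥0∞) ^ 2)⁻¹ * (ENNReal.ofReal U * u) := mul_le_mul_right h _
    _ = ENNReal.ofReal U / (K : ℝ≥0∞) ^ 2 * u := by rw [div_eq_mul_inv]; ring

/-- The constant: `C/n + Σ_c (C 2^{c+1}/n)(U/4^c) = C(1 + 4U)/n`. -/
theorem const_sum (C U : ℝ) (hC : 0 ≤ C) (hU : 0 ≤ U) (n : ℕ) (hn : 1 ≤ n) :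
    ENNReal.ofReal (C * ((1 : ℕ) : ℝ) / n) +
        ∑' c : ℕ, ENNReal.ofReal (C * ((2 ^ (c + 1) : ℕ) : ℝ) / n) *
          ENNReal.ofReal (U / ((2 ^ c : ℕ) : ℝ) ^ 2) =
      ENNReal.ofReal (C * (1 + 4 * U) / n) := by
  have hn' : (n : ℝ) ≠ 0 := by exact_mod_cast (show n ≠ 0 by omega)
  have hterm : ∀ c : ℕ, ENNReal.ofReal (C * ((2 ^ (c + 1) : ℕ) : ℝ) / n) *
      ENNReal.ofReal (U / ((2 ^ c : ℕ) : ℝ) ^ 2) = ENNReal.ofReal (2 * C * U / n * (1 / 2) ^ c) := by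
    intro c
    rw [← ENNReal.ofReal_mul (by positivity)]
    congr 1
    have hx : (0 : ℝ) < (2 : ℝ) ^ c := by positivity
    push_cast
    rw [one_div_pow, pow_succ]
    field_simp
  have hg : Summable fun c : ℕ => 2 * C * U / n * (1 / 2 : ℝ) ^ c := summable_geometric_two.mul_left _
  rw [tsum_congr hterm, ← ENNReal.ofReal_tsum_of_nonneg (fun c => by positivity) hg, tsum_mul_left,
    tsum_geometric_two, ← ENNReal.ofReal_add (by positivity) (by positivity)]
  congr 1
  push_cast
  ring

/-- The end height of the concatenation of a tuple of words is the sum of their height increments. -/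
theorem wEnd_flatten_ofFn : ∀ {k : ℕ} (g : Fin k → List Step),
    wEnd (List.ofFn g).flatten 1 = ∑ j, wEnd (g j) 1
  | 0, g => by simp
  | k + 1, g => by
    rw [List.ofFn_succ, List.flatten_cons, wEnd_append, Pi.add_apply, wEnd_flatten_ofFn, Fin.sum_univ_succ]

end PinnedDen

open PinnedDen in
/-- **Stub Den `stub_pinnedDenominator`** (registered): AR → USP → PinnedAtomCeiling — the end height of a
Kesten chain of span `n ≥ 1` has every atom `≤ (C(1 + 4 C_U)/n)·u_n`, where `C` is the AR constant and
`C_U` the USP constant. -/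
theorem stub_pinnedDenominator :
    (∃ C : ℝ, 0 < C ∧ ∀ s : ℕ, 1 ≤ s → ∀ h : ℤ,
      (∑' w : {w : List Step // IsIrrBridge w},
          {w : {w : List Step // IsIrrBridge w} | xEnd w.1 = s ∧ wEnd w.1 1 = h}.indicator
            (fun w => criticalFugacity ^ w.1.length) w) ≤
        C / s * ∑' w : {w : List Step // IsIrrBridge w},
          {w : {w : List Step // IsIrrBridge w} | xEnd w.1 = s}.indicator
            (fun w => criticalFugacity ^ w.1.length) w) →
    (∃ C : ℝ, 0 < C ∧ ∀ K n : ℕ, 1 ≤ K →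
      (K : ℝ≥0∞) ^ 2 *
          (∑' l : {l : List (List Step) // (∀ w ∈ l, IsIrrBridge w) ∧ (l.map xEnd).sum = (n : ℤ) ∧
              ∀ w ∈ l, (K : ℤ) * xEnd w < (n : ℤ)},
            ENNReal.ofReal (criticalFugacity ^ (l.1.map List.length).sum)) ≤
        ENNReal.ofReal C *
          ∑' l : {l : List (List Step) // (∀ w ∈ l, IsIrrBridge w) ∧ (l.map xEnd).sum = (n : ℤ) ∧ True},
            ENNReal.ofReal (criticalFugacity ^ (l.1.map List.length).sum)) →
    (∃ C : ℝ, 0 < C ∧ ∀ n : ℕ, 1 ≤ n → ∀ h : ℤ,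
      (∑' l : {l : List (List Step) // (∀ w ∈ l, IsIrrBridge w) ∧ (l.map xEnd).sum = (n : ℤ) ∧
          wEnd l.flatten 1 = h},
        ENNReal.ofReal (criticalFugacity ^ (l.1.map List.length).sum)) ≤
        ENNReal.ofReal (C / n) *
          ∑' l : {l : List (List Step) // (∀ w ∈ l, IsIrrBridge w) ∧ (l.map xEnd).sum = (n : ℤ) ∧ True},
            ENNReal.ofReal (criticalFugacity ^ (l.1.map List.length).sum)) := by
  rintro ⟨C, hC, hAR⟩ ⟨U, hU, hUSP⟩
  refine ⟨C * (1 + 4 * U), by positivity, fun n hn h => ?_⟩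
  -- the masses in tuple form
  rw [chainSpanMass_eq_tsum_tuples (fun l => wEnd l.flatten 1 = h) (n : ℤ),
    chainSpanMass_eq_tsum_tuples (fun _ => True) (n : ℤ)]
  simp only [and_true, wEnd_flatten_ofFn]
  have husp : ∀ K : ℕ, 1 ≤ K →
      (K : ℝ≥0∞) ^ 2 * (∑' k : ℕ, ∑' f : Fin k → {w : List Step // IsIrrBridge w},
        if ((∑ j, xEnd (f j).1) = (n : ℤ) ∧ ∀ j : Fin k, (K : ℤ) * xEnd (f j).1 < (n : ℤ)) then
          ∏ j, ENNReal.ofReal (criticalFugacity ^ (f j).1.length) else 0) ≤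
      ENNReal.ofReal U * ∑' k : ℕ, ∑' f : Fin k → {w : List Step // IsIrrBridge w},
        if (∑ j, xEnd (f j).1) = (n : ℤ) then ∏ j, ENNReal.ofReal (criticalFugacity ^ (f j).1.length) else 0 := by
    intro K hK
    have h1 := hUSP K n hK
    rw [chainSpanMass_eq_tsum_tuples (fun l => ∀ w ∈ l, (K : ℤ) * xEnd w < (n : ℤ)) (n : ℤ),
      chainSpanMass_eq_tsum_tuples (fun _ => True) (n : ℤ)] at h1
    simpa only [and_true, List.forall_mem_ofFn_iff] using h1
  -- AR in `ℝ≥0∞` on the fibre of the cut piece of a class `m` (`n ≤ m·s`, so `s ≥ 1` and `C/s ≤ Cm/n`)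
  have hrate : ∀ (m : ℕ) (s t : ℤ), (n : ℤ) ≤ (m : ℤ) * s →
      (∑' p : {w : List Step // IsIrrBridge w},
        if (xEnd p.1 = s ∧ wEnd p.1 1 = t) then ENNReal.ofReal (criticalFugacity ^ p.1.length) else 0) ≤
      ENNReal.ofReal (C * m / n) * ∑' p : {w : List Step // IsIrrBridge w},
        if xEnd p.1 = s then ENNReal.ofReal (criticalFugacity ^ p.1.length) else 0 := by
    intro m s t hms
    have hs1 : 1 ≤ s := by
      by_contra hlt
      have : (m : ℤ) * s ≤ 0 := mul_nonpos_of_nonneg_of_nonpos (by positivity) (by omega)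
      omega
    obtain ⟨s, rfl⟩ : ∃ s' : ℕ, s = (s' : ℤ) := ⟨s.toNat, (Int.toNat_of_nonneg (by omega)).symm⟩
    have hs1' : 1 ≤ s := by exact_mod_cast hs1
    have h1 := ENNReal.ofReal_le_ofReal (hAR s hs1' t)
    rw [ENNReal.ofReal_mul (by positivity), ExtentOfExpTail.ofReal_tsum_indicator,
      ExtentOfExpTail.ofReal_tsum_indicator] at h1
    refine h1.trans (mul_le_mul_left (ENNReal.ofReal_le_ofReal ?_) _)
    have hsR : (0 : ℝ) < s := by exact_mod_cast hs1'
    have hle : (n : ℝ) ≤ (m : ℝ) * s := by exact_mod_cast hms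
    rw [div_le_div_iff₀ hsR (by exact_mod_cast hn)]
    nlinarith [mul_le_mul_of_nonneg_left hle hC.le]
  -- the per-class bounds, classes `(m, K)`; at most one first big index (trichotomy)
  have hcls := fun m K : ℕ => class_bound
    (fun p : {w : List Step // IsIrrBridge w} => ENNReal.ofReal (criticalFugacity ^ p.1.length))
    (fun p => xEnd p.1) (fun p => wEnd p.1 1) (ENNReal.ofReal (C * m / n)) (n : ℤ) h
    (fun k i v => (n : ℤ) ≤ (m : ℤ) * v i ∧ ∀ j : Fin k, (j : ℕ) < (i : ℕ) → (m : ℤ) * v j < (n : ℤ))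
    (fun k v => ∀ j : Fin k, (K : ℤ) * v j < (n : ℤ))
    (fun k v i i' hi hi' => by
      rcases lt_trichotomy (i : ℕ) (i' : ℕ) with hlt | heq | hgt
      · exact absurd hi.1 (not_le.2 (hi'.2 i hlt))
      · exact Fin.ext heq
      · exact absurd hi'.1 (not_le.2 (hi.2 i' hgt)))
    (fun k v i t hv => hrate m (v i) t hv.1)
  have step2 := add_le_add (hcls 1 0) (ENNReal.tsum_le_tsum fun c => hcls (2 ^ (c + 1)) (2 ^ c))
  refine le_trans ?_ (le_trans step2 ?_)
  · -- coverage: every pinned tuple lies in a class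
    refine tsum_cover _ _ _ fun k f => ?_
    by_cases hcond : (∑ j, xEnd (f j).1) = (n : ℤ) ∧ (∑ j, wEnd (f j).1 1) = h
    · rw [if_pos hcond]
      rcases cover n hn (fun j => xEnd (f j).1) (fun j => UnpinnedSlabTube.one_le_xEnd (f j)) hcond.1 with
        ⟨i, h1, h2⟩ | ⟨c, i, h1, h2⟩
      · refine le_trans ?_ le_self_add
        refine le_trans (le_of_eq ?_) (Finset.single_le_sum (fun _ _ => zero_le) (Finset.mem_univ i))
        rw [if_pos ⟨⟨hcond.1, h1, h2⟩, hcond.2⟩]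
      · refine le_trans (le_trans ?_ (ENNReal.le_tsum c)) le_add_self
        refine le_trans (le_of_eq ?_) (Finset.single_le_sum (fun _ _ => zero_le) (Finset.mem_univ i))
        rw [if_pos ⟨⟨hcond.1, h1, h2⟩, hcond.2⟩]
    · rw [if_neg hcond]
      exact zero_le
  · -- USP on the classes (`K = 2^c`; the class `(1, 0)` by monotonicity) and the geometric series
    have hMc := fun c : ℕ => usp_div (2 ^ c) Nat.one_le_two_pow _ _ U (husp (2 ^ c) Nat.one_le_two_pow)
    refine le_trans (add_le_add (mul_le_mul_right (tsum_tsum_ite_and_le _ _ _) _)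
      (ENNReal.tsum_le_tsum fun c => mul_le_mul_right (hMc c) _)) (le_of_eq ?_)
    rw [← const_sum C U hC.le hU.le n hn, add_mul, ← ENNReal.tsum_mul_right]
    simp only [mul_assoc]

end Summit.CriticalPhenomena.SAWScalingLimit.Theorems
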